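import Mathlib
import Summits.ValiantsHypothesis.ValiantsHypothesis.Theorems.ValuativeGCTHeadFlipRankBoundDefs

/-!
# Bookkeeping maps for the count of the rank certificate (line `four-row-count`, crux `HeadFlip`)

Second definitions file of the rank certificate `stub_rankBound` (blueprint
`Cruxes/HeadFlip/Lines/four_row_count.md` §5): the two linear "bookkeeping" maps on the coefficient
space `Fin 3 × (Fin n × Fin n) → ℂ` of the `3n²` generators `rbGen`,
* `rbRho h3 : c ↦ (diagonal A-coefficients of c, coefficient vectors of q_{αb}(c) for the three
  apexes α = 0,1,2)` with target `Y = (Fin n → ℂ) × (Fin n → ℂ) × (Fin 3 × Fin n → Fin 4 → ℂ)` of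
  dimension `14n` (`finrank_rbY`),
* `rbKappa n : c ↦ (s ↦ y₃y₁-coefficient of q_s(c))` on unordered pairs `s`, target of dimension
  `C(n,2)` (`stub_rbCardPairs`),
whose joint kernel meets the relation space trivially (proved in `…RankBoundCount.lean`), whence
`dim(relations) ≤ 14n + C(n,2)`. [this crux; new]
-/

set_option linter.dupNamespace false

namespace Summit.ValiantsHypothesis.ValiantsHypothesis.Theorems.HeadFlip

open MvPolynomial Finset
open scoped BigOperators

noncomputable section

variable {n : ℕ}

/-- The bookkeeping map `ρ₀ : c ↦ (diagonal A-coefficients, coefficient vectors of q_{αb} for the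
three apexes α)` on the whole coefficient space; `Y` has dimension `14n`. -/
def rbRho (h3 : 3 ≤ n) : (Fin 3 × (Fin n × Fin n) → ℂ) →ₗ[ℂ]
    ((Fin n → ℂ) × ((Fin n → ℂ) × (Fin 3 × Fin n → Fin 4 → ℂ))) where
  toFun c := (fun a => c (0, (a, a)), (fun a => c (1, (a, a)), fun rb =>
    ![c (1, (Fin.castLE h3 rb.1, rb.2)) * rbA rb.2 ^ 2 + c (1, (rb.2, Fin.castLE h3 rb.1)) * rbA (Fin.castLE h3 rb.1) ^ 2,
      c (1, (Fin.castLE h3 rb.1, rb.2)) * rbA rb.2 ^ 3 + c (1, (rb.2, Fin.castLE h3 rb.1)) * rbA (Fin.castLE h3 rb.1) ^ 3,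
      c (0, (Fin.castLE h3 rb.1, rb.2)) * rbA rb.2 ^ 2 + c (0, (rb.2, Fin.castLE h3 rb.1)) * rbA (Fin.castLE h3 rb.1) ^ 2,
      c (0, (Fin.castLE h3 rb.1, rb.2)) * rbA rb.2 ^ 3 + c (0, (rb.2, Fin.castLE h3 rb.1)) * rbA (Fin.castLE h3 rb.1) ^ 3]))
  map_add' c c' := by
    refine Prod.ext (funext fun a => rfl) (Prod.ext (funext fun a => rfl) (funext fun rb => funext fun t => ?_))
    fin_cases t <;> simp [Pi.add_apply] <;> ring
  map_smul' r c := by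
    refine Prod.ext (funext fun a => rfl) (Prod.ext (funext fun a => rfl) (funext fun rb => funext fun t => ?_))
    fin_cases t <;> simp [Pi.smul_apply] <;> ring

/-- The `y₃y₁`-coefficient of `q_s` for an unordered pair `s = {a < b}`. -/
def rbKappa (n : ℕ) : (Fin 3 × (Fin n × Fin n) → ℂ) →ₗ[ℂ] (↥((Finset.univ : Finset (Fin n)).powersetCard 2) → ℂ) where
  toFun c := fun s =>
    c (1, (s.1.min' (Finset.card_pos.1 (by rw [(Finset.mem_powersetCard.1 s.2).2]; norm_num)),
      s.1.max' (Finset.card_pos.1 (by rw [(Finset.mem_powersetCard.1 s.2).2]; norm_num)))) *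
      rbA (s.1.max' (Finset.card_pos.1 (by rw [(Finset.mem_powersetCard.1 s.2).2]; norm_num))) ^ 2 +
    c (1, (s.1.max' (Finset.card_pos.1 (by rw [(Finset.mem_powersetCard.1 s.2).2]; norm_num)),
      s.1.min' (Finset.card_pos.1 (by rw [(Finset.mem_powersetCard.1 s.2).2]; norm_num)))) *
      rbA (s.1.min' (Finset.card_pos.1 (by rw [(Finset.mem_powersetCard.1 s.2).2]; norm_num))) ^ 2
  map_add' c c' := by ext s; simp only [Pi.add_apply]; ring
  map_smul' r c := by ext s; simp only [Pi.smul_apply, smul_eq_mul, RingHom.id_apply]; ring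

/-- `dim Y = 14 n`. -/
theorem finrank_rbY (n : ℕ) :
    Module.finrank ℂ ((Fin n → ℂ) × ((Fin n → ℂ) × (Fin 3 × Fin n → Fin 4 → ℂ))) = 14 * n := by
  have h1 : Module.finrank ℂ (Fin n → ℂ) = n := by
    rw [Module.finrank_fintype_fun_eq_card, Fintype.card_fin]
  have h2 : Module.finrank ℂ (Fin 3 × Fin n → Fin 4 → ℂ) = 12 * n := by
    rw [Module.finrank_pi_fintype]
    simp only [Module.finrank_fintype_fun_eq_card, Fintype.card_fin, Finset.sum_const, Finset.card_univ,
      Fintype.card_prod, smul_eq_mul]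
    ring
  rw [Module.finrank_prod, Module.finrank_prod, h1, h2]
  ring

/-- **stub_rbCardPairs** (registered anchor of this file): the number of unordered pairs of `Fin n` is
`C(n,2)`. [folklore] -/
theorem stub_rbCardPairs : ∀ (n : ℕ),
    Fintype.card ↥((Finset.univ : Finset (Fin n)).powersetCard 2) = n.choose 2 := by
  intro n
  rw [Fintype.card_coe, Finset.card_powersetCard, Finset.card_univ, Fintype.card_fin]


end

end Summit.ValiantsHypothesis.ValiantsHypothesis.Theorems.HeadFlip
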